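import Summits.QuantumFields.BalabanUV.Beta.GAN24.HkGradientSecant

/-!
# `BalabanUV.Beta.GAN24.HkGradientKingOneStep` — binder row G-an2-4 ∕ (CONV-C), route R7 (ρ3) GRADIENT PART, road P2: the ONE-STEP LAW OF THE
# GRADIENT LEG `∂_νH_k` AGAINST KING's BLOCK PARENT, kernel currency, every torus — REDUCED BY SECANT INTERPOLATION to the VALUE law of `H_k`
# (a DISPLAYED letter `ε`, supplied in the tree by gan24-p3-g27's `HkKingOneStep.norm_HkOp_king_sub_le` with `ε = KH1(d)∕N·e^{−dec|y′−y|}`):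
# `‖∂_ν^{(RN)}H_{RN}((RN·ȳ′+a′,μ),(ȳ,λ)) − ∂_ν^{(N)}H_N((N·ȳ′+⌊a′∕R⌋,μ),(ȳ,λ))‖ ≤ 2·CHR(d,α)·(h∕N)^α·e^{−δ|y′−y|_T} + 2·(N∕h)·ε` for every `1 ≤ h ≤ N∕2`

NOT IN PRINT; OUR PROOF ATTEMPT (unit `b2b-balaban-gan24-p2`, gen 31 = prover-b2b-balaban-gan24-p2-g31-0, road-P2 chair of row G-an2-4;
CRUX TEAM (2) under the ruling «YM REDIRECT TOWARDS THE SUMMIT», 2026-08-21).  HONEST FRAMING (cell contract, verbatim): «discharging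
`BetaPertH` makes Bałaban's UV stability UNCONDITIONAL — a real constructive-QFT result; it is NOT the continuum limit and NOT the Clay
problem.»  HONEST DEPENDENCY (verbatim): «continuum YM on T⁴ ⇐ BetaPertH ∧ nine spine estimates (0/9 proved); BetaPertH ⇐ (D1) ∧ (D4) ∧
CAP+tail; G-an2-4 gates asym, D1 and NE2/3/4.»  ABSOLUTE RULE: nothing printed is a hypothesis; no `def … : Prop`, no `sorry`; [folklore]
real analysis over TREE theorems BY NAME (b05's `B5Hk163TorusHolderRate.norm_dker_sub_le_rate` through `GAN24/HkGradientSecant`).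

## What and why

`HOME/beta/ROUTES-GAN24.md` v10 §2 R7 S3 (ρ3) lists the one-step rate of the GRADIENT leg `∂_νH_k` (needed by every chain with a DIFFERENCE
vertex between two hard legs, an1's rows T1–T3) as «TO PROVE (S–M)», nobody's in (u).  The VALUE leg's law against King's parent map is
gan24-p3-g27's (`HkKingOneStep`, filed 2026-08-21); b05 holds the UNIFORM decaying `α`-Hölder bound of the gradient kernel at the full decay
rate.  Secant interpolation joins them: the gradient kernel at a point is within `CHR·(h∕n)^α` of the secant slope of `H` over `h` in-block
steps (`HkGradientSecant.norm_dker_sub_secant_HkOp_le`, at EACH level, with `R·h` steps at level `RN` so that the two secants span the SAME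
physical segment and have the SAME prefactor `RN∕(Rh) = N∕h`), and the two secant slopes differ by `(N∕h)×` two value differences at
parent-related endpoints.  Hence, with the value law as a displayed letter `ε` (§2) or as p3's theorem (the plug is a separate 30-line file
once `HkKingOneStep` is in the tree):
 * §1 `rayOff_par` ∕ `rayOff_par_mul` (parent relations are preserved along the paired rays), `rayOff_back` (the backward ray ends at the given
   offset), `lt_of_par_lt` (room at level `RN` from room at level `N`), `cast_div_mul` (`(RN)∕(Rh) = N∕h`).
 * §2 **`norm_dker_sub_dker_ray_le`** (core, paired in-block rays, any position `t₀ ≤ h`, evaluation at `R·t₀` upstairs):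
   `‖dker_{RN}(P′(R t₀)) − dker_N(P t₀)‖ ≤ 2·CHR(d,α)·(h∕N)^α·E + (N∕h)·(ε₀ + ε_h)`, `E = e^{−(κ₁₆₃(d+1)∕(d+1))|x′−x|_T}`, where `ε₀, ε_h` bound the
   two endpoint value differences `‖H_{RN}(P′ 0) − H_N(P 0)‖`, `‖H_{RN}(P′(Rh)) − H_N(P h)‖`.
 * §3 **`norm_dker_king_sub_le_of_value_law`** (THE GRADIENT ONE-STEP LAW MODULO THE VALUE LETTER): if
   `‖H_{RN}((RN·x̄′+a′,μ),(x̄,λ)) − H_N((N·x̄′+a,μ),(x̄,λ))‖ ≤ ε` for ALL parent-related offset pairs `(a′, a)` in the block `x′` (one `ε ≥ 0`, the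
   decay factor being part of `ε`), then for every parent-related pair, every direction `ν`, every `h` with `1 ≤ h`, `2h ≤ N`, and `0 ≤ α < 1`:
   `‖∂_ν^{(RN)}H_{RN}((RN·x̄′+a′,μ),(x̄,λ)) − ∂_ν^{(N)}H_N((N·x̄′+a,μ),(x̄,λ))‖ ≤ 2·CHR(d,α)·(h∕N)^α·E + 2·(N∕h)·ε`
   (forward ray if `a_ν + h < N`, else backward — `2h ≤ N` guarantees one fits).  With p3's `ε = KH1(d)∕N·E` the right side is
   `(2·CHR(d,α)·(h∕N)^α + 2·KH1(d)∕h)·E`; `h ≍ N^{1∕(1+α)}` gives the rate `N^{−α∕(1+α)}` (any exponent `< ½`), `h = L^{⌊k∕2⌋}` along `N = L^k` the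
   geometric rate `(L^{−α∕2})^k` — WITH the decay, so both (CONV-C) clauses hold for the constituent family `∂H_k` (decay clause = b05's
   `B5Hk163TorusHolderDecay.norm_dker_bpt_le`, restated as `norm_dker_trivial_two_levels` for the degenerate case).
HONEST SCOPE.  Torus model (`U = 1`, `m² = 0`, dimension `d+1 ≥ 1`), every `N, R ≥ 1`, every period vector; constants b05's `CHR(d,α)` (diverges as
`α ↑ 1`); the exponent `α∕(1+α) < ½` is what interpolation of THESE two inputs gives (Landau–Kolmogorov-sharp for the pair: gan24-idea-1 g11,
W-idea1-g11-1) and is BELOW the `η^γ, ∀ γ < 1` (constants blowing up as `γ ↑ 1`) that King's §4 alias count would give for the pure gradient line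
([King1986] (4.25) p. 673 «keeping γ + α < 1», located by gan24-leaf-04 g51); `η¹` is NOT claimed anywhere in print for `∂H_k`, and idea-1's scalar
toy j132961 measures `η·log(1∕η)` in sup (corner log of the mixed second differences); (CONV-C)'s `θ` is free.  NOT (CONV-C) as a whole, NEVER
«G-an2-4 closed», NOT NE2, NOT D1, NOT BetaPertH, NOT continuum, NOT Clay.  Text locations only: [Balaban1984PropagatorsI] (1.63) p. 28, p. 29
lines 1–2; [King1986] p. 664 (parent map), (4.25) p. 673 (the printed momentum-for-η trade).
-/

noncomputable section

open scoped BigOperators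
open Finset

namespace Summit.QuantumFields.BalabanUV.Beta.GAN24.HkGradientKingOneStep

open Literature.MathematicalPhysics.QuantumFieldTheory.Balaban1983to89
open Literature.MathematicalPhysics.QuantumFieldTheory.Balaban1983to89.B5Prop11Plancherel (Tor fine unitVec)
open Literature.MathematicalPhysics.QuantumFieldTheory.Balaban1983to89.B4ContourShift (supNorm)
open Literature.MathematicalPhysics.QuantumFieldTheory.Balaban1983to89.B4TorusKernel (periodConst)
open Literature.MathematicalPhysics.QuantumFieldTheory.Balaban1983to89.B4TorusKernel.MultiPeriod (torusSupNorm)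
open Literature.MathematicalPhysics.QuantumFieldTheory.Balaban1983to89.B5Block118 (bpt tstep)
open Literature.MathematicalPhysics.QuantumFieldTheory.Balaban1983to89.B6LowerBound2153Torus (toT)
open Literature.MathematicalPhysics.QuantumFieldTheory.Balaban1983to89.B5Hk163Strip (kappa163 kappa163_pos)
open Literature.MathematicalPhysics.QuantumFieldTheory.Balaban1983to89.B5Hk163Torus (hker HkOp)
open Literature.MathematicalPhysics.QuantumFieldTheory.Balaban1983to89.B5Hk163TorusHolder (dker)
open Literature.MathematicalPhysics.QuantumFieldTheory.Balaban1983to89.B5Hk163TorusHolderDecay (CdecD CdecD_nonneg norm_dker_bpt_le)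
open Literature.MathematicalPhysics.QuantumFieldTheory.Balaban1983to89.B5Hk163TorusHolderRate (CHR CHR_nonneg)
open Summit.QuantumFields.BalabanUV.Beta.GAN24.HkGradientSecant (rayOff rayPt rayPt_zero norm_dker_sub_secant_HkOp_le)

variable {d : ℕ}

/-! ## §1 Bookkeeping: parent relations along paired rays -/

section Book

variable {N R : ℕ}

/-- `⌊(x + R·t)∕R⌋ = ⌊x∕R⌋ + t` (`R ≥ 1`). [folklore] -/
theorem add_mul_div (hR : 0 < R) (x t : ℕ) : (x + R * t) / R = x / R + t := by
  rw [Nat.mul_comm, Nat.add_mul_div_right _ _ hR]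

/-- `⌊(x − R·t)∕R⌋ = ⌊x∕R⌋ − t`. [folklore] -/
theorem sub_mul_div (x t : ℕ) : (x - R * t) / R = x / R - t := Nat.sub_mul_div x R t

/-- room upstairs from room downstairs: `⌊x∕R⌋ + t < N ⇒ x + R·t < R·N`. [folklore] -/
theorem lt_of_par_lt (hR : 0 < R) {x t : ℕ} (h : x / R + t < N) : x + R * t < R * N := by
  have h1 : x < R * (x / R + 1) := by
    have := Nat.lt_mul_div_succ x hR
    linarith [Nat.mul_comm (x / R + 1) R]
  have h2 : x / R + 1 + t ≤ N := by omega
  calc x + R * t < R * (x / R + 1) + R * t := by omega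
    _ = R * (x / R + 1 + t) := by ring
    _ ≤ R * N := Nat.mul_le_mul_left _ h2

/-- `R·⌊x∕R⌋ ≤ x`, so `t ≤ ⌊x∕R⌋ ⇒ R·t ≤ x`. [folklore] -/
theorem mul_le_of_le_par {x t : ℕ} (h : t ≤ x / R) : R * t ≤ x :=
  (Nat.mul_le_mul_left R h).trans (Nat.mul_div_le x R)

variable (ν : Fin (d + 1))

/-- the parent relation is preserved along the paired rays: `⌊(c′ + R·t·e_ν)_i ∕ R⌋ = (c + t·e_ν)_i`. [folklore] -/
theorem rayOff_par (hR : 0 < R) (c : Fin (d + 1) → Fin N) (c' : Fin (d + 1) → Fin (R * N)) (hpar : ∀ i, (c' i : ℕ) / R = (c i : ℕ))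
    (t : ℕ) (ht : (c ν : ℕ) + t < N) (i : Fin (d + 1)) :
    ((rayOff (R * N) c' ν (R * t) i : ℕ)) / R = (rayOff N c ν t i : ℕ) := by
  have ht' : (c' ν : ℕ) + R * t < R * N := lt_of_par_lt hR (by rw [hpar ν]; exact ht)
  unfold rayOff
  rw [dif_pos ht', dif_pos ht]
  by_cases hi : i = ν
  · subst hi
    simp only [Function.update_self, Fin.val_mk]
    rw [add_mul_div hR, hpar]
  · simp only [Function.update_of_ne hi]
    exact hpar i

/-- the backward ray based at `a − h·e_ν` ends at `a`: `rayOff (update a ν (a_ν − h)) ν h = a` (`h ≤ a_ν`). [folklore] -/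
theorem rayOff_back (a : Fin (d + 1) → Fin N) {h : ℕ} (hh : h ≤ (a ν : ℕ)) :
    rayOff N (Function.update a ν ⟨(a ν : ℕ) - h, lt_of_le_of_lt (Nat.sub_le _ _) (a ν).isLt⟩) ν h = a := by
  unfold rayOff
  have hlt : ((Function.update a ν ⟨(a ν : ℕ) - h, lt_of_le_of_lt (Nat.sub_le _ _) (a ν).isLt⟩ ν : ℕ)) + h < N := by
    simp only [Function.update_self, Fin.val_mk]
    have := (a ν).isLt; omega
  rw [dif_pos hlt]
  funext i
  by_cases hi : i = ν
  · subst hi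
    simp only [Function.update_self]
    exact Fin.ext (by simp only; omega)
  · simp only [Function.update_of_ne hi]

/-- `rayOff c ν 0 = c`. [folklore] -/
theorem rayOff_zero (c : Fin (d + 1) → Fin N) : rayOff N c ν 0 = c := by
  unfold rayOff
  rw [dif_pos (by simp)]
  funext i
  by_cases hi : i = ν
  · subst hi; simp
  · simp [Function.update_of_ne hi]

/-- `(R·N : ℂ)∕(R·h) = N∕h` (`R ≠ 0`). [folklore] -/
theorem cast_div_mul (hR : R ≠ 0) (h : ℕ) : (((R * N : ℕ) : ℂ)) / ((R * h : ℕ) : ℂ) = (N : ℂ) / h := by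
  have hR' : (R : ℂ) ≠ 0 := by exact_mod_cast hR
  push_cast
  rw [mul_div_mul_left _ _ hR']

end Book

/-! ## §2 The core: paired in-block rays -/

section Core

variable {N R : ℕ} [NeZero N] [NeZero R] (M : Fin (d + 1) → ℕ) [hM : ∀ μ, NeZero (M μ)]

/-- **THE CORE INTERPOLATION ON PAIRED RAYS**: level-`N` ray `P t = N·x̄′ + c + t·e_ν` (`c_ν + h < N`, `h ≥ 1`), level-`RN` ray
`P′ s = RN·x̄′ + c′ + s·e_ν` with `⌊c′∕R⌋ = c` (so `P′(R t)` has parent `P t`); if the VALUES satisfy `‖H_{RN}(P′ 0) − H_N(P 0)‖ ≤ ε₀` and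
`‖H_{RN}(P′(R h)) − H_N(P h)‖ ≤ ε₁`, then for every `t₀ ≤ h` and `0 ≤ α < 1`
`‖∂_ν^{(RN)}H_{RN}(P′(R t₀)) − ∂_ν^{(N)}H_N(P t₀)‖ ≤ 2·CHR(d,α)·(h∕N)^α·e^{−(κ₁₆₃(d+1)∕(d+1))|x′−x|_T} + (N∕h)·(ε₀ + ε₁)` (entries against the unit
source `(x̄, λ)`, component `μ`). [folklore] -/
theorem norm_dker_sub_dker_ray_le (μ lam ν : Fin (d + 1)) (x' x : Fin (d + 1) → ℤ) (c : Fin (d + 1) → Fin N)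
    (c' : Fin (d + 1) → Fin (R * N)) (hpar : ∀ i, (c' i : ℕ) / R = (c i : ℕ)) {h : ℕ} (hh : 1 ≤ h) (hch : (c ν : ℕ) + h < N)
    {t₀ : ℕ} (ht₀ : t₀ ≤ h) {α : ℝ} (hα0 : 0 ≤ α) (hα1 : α < 1) {ε₀ ε₁ : ℝ}
    (hε₀ : ‖HkOp (R * N) M (rayPt (R * N) M x' c' ν 0, μ) (toT M x, lam) - HkOp N M (rayPt N M x' c ν 0, μ) (toT M x, lam)‖ ≤ ε₀)
    (hε₁ : ‖HkOp (R * N) M (rayPt (R * N) M x' c' ν (R * h), μ) (toT M x, lam) - HkOp N M (rayPt N M x' c ν h, μ) (toT M x, lam)‖ ≤ ε₁) :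
    ‖dker (R * N) M μ lam ν (rayPt (R * N) M x' c' ν (R * t₀)) (toT M x) - dker N M μ lam ν (rayPt N M x' c ν t₀) (toT M x)‖
      ≤ 2 * CHR d α * ((h : ℝ) / N) ^ α * Real.exp (-(kappa163 (d + 1) / (d + 1) * torusSupNorm M (x' - x)))
        + (N : ℝ) / h * (ε₀ + ε₁) := by
  have hR : 0 < R := Nat.pos_of_ne_zero (NeZero.ne R)
  have hN : (0 : ℝ) < N := by exact_mod_cast Nat.pos_of_ne_zero (NeZero.ne N)
  have hhR : (0 : ℝ) < h := by exact_mod_cast hh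
  set E : ℝ := Real.exp (-(kappa163 (d + 1) / (d + 1) * torusSupNorm M (x' - x))) with hE
  -- room upstairs
  have hch' : (c' ν : ℕ) + R * h < R * N := lt_of_par_lt hR (by rw [hpar ν]; exact hch)
  -- the two one-level secant laws
  have hRh : 1 ≤ R * h := Nat.le_of_lt_succ (by nlinarith)
  have hup := norm_dker_sub_secant_HkOp_le (R * N) M μ lam ν x' x c' hRh hch' (Nat.mul_le_mul_left R ht₀) hα0 hα1
  have hdn := norm_dker_sub_secant_HkOp_le N M μ lam ν x' x c hh hch ht₀ hα0 hα1
  -- the prefactors agree: `(RN)/(Rh) = N/h`, and `(Rh)/(RN) = h/N`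
  rw [cast_div_mul (NeZero.ne R)] at hup
  have hratio : (((R * h : ℕ) : ℝ)) / ((R * N : ℕ) : ℝ) = (h : ℝ) / N := by
    have hR' : (R : ℝ) ≠ 0 := by exact_mod_cast hR.ne'
    push_cast; rw [mul_div_mul_left _ _ hR']
  rw [hratio] at hup
  -- abbreviations
  set D' := dker (R * N) M μ lam ν (rayPt (R * N) M x' c' ν (R * t₀)) (toT M x)
  set D := dker N M μ lam ν (rayPt N M x' c ν t₀) (toT M x)
  set φ'h := HkOp (R * N) M (rayPt (R * N) M x' c' ν (R * h), μ) (toT M x, lam)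
  set φ'0 := HkOp (R * N) M (rayPt (R * N) M x' c' ν 0, μ) (toT M x, lam)
  set φh := HkOp N M (rayPt N M x' c ν h, μ) (toT M x, lam)
  set φ0 := HkOp N M (rayPt N M x' c ν 0, μ) (toT M x, lam)
  -- the secant slopes differ by `(N/h) ×` the endpoint value differences
  have hsec : ‖(N : ℂ) / h * (φ'h - φ'0) - (N : ℂ) / h * (φh - φ0)‖ ≤ (N : ℝ) / h * (ε₀ + ε₁) := by
    rw [← mul_sub, norm_mul, show (φ'h - φ'0 - (φh - φ0)) = (φ'h - φh) - (φ'0 - φ0) by ring]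
    have hq : ‖(N : ℂ) / h‖ = (N : ℝ) / h := by
      rw [norm_div, Complex.norm_natCast, Complex.norm_natCast]
    rw [hq]
    refine mul_le_mul_of_nonneg_left ?_ (div_nonneg hN.le hhR.le)
    calc ‖(φ'h - φh) - (φ'0 - φ0)‖ ≤ ‖φ'h - φh‖ + ‖φ'0 - φ0‖ := norm_sub_le _ _
      _ ≤ ε₁ + ε₀ := add_le_add hε₁ hε₀
      _ = ε₀ + ε₁ := add_comm _ _
  calc ‖D' - D‖ = ‖(D' - (N : ℂ) / h * (φ'h - φ'0)) + ((N : ℂ) / h * (φ'h - φ'0) - (N : ℂ) / h * (φh - φ0))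
        + ((N : ℂ) / h * (φh - φ0) - D)‖ := by congr 1; ring
    _ ≤ ‖D' - (N : ℂ) / h * (φ'h - φ'0)‖ + ‖(N : ℂ) / h * (φ'h - φ'0) - (N : ℂ) / h * (φh - φ0)‖ + ‖(N : ℂ) / h * (φh - φ0) - D‖ :=
        norm_add₃_le
    _ ≤ CHR d α * ((h : ℝ) / N) ^ α * E + (N : ℝ) / h * (ε₀ + ε₁) + CHR d α * ((h : ℝ) / N) ^ α * E := by
        refine add_le_add (add_le_add hup hsec) ?_
        rw [norm_sub_rev]; exact hdn
    _ = 2 * CHR d α * ((h : ℝ) / N) ^ α * E + (N : ℝ) / h * (ε₀ + ε₁) := by ring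

end Core

/-! ## §3 The gradient one-step law against King's parent, modulo the value letter -/

section Law

variable {N R : ℕ} [NeZero N] [NeZero R] (M : Fin (d + 1) → ℕ) [hM : ∀ μ, NeZero (M μ)]

/-- **THE ONE-STEP LAW OF THE GRADIENT LEG `∂_νH_k` AGAINST KING's PARENT MAP, MODULO THE VALUE LETTER** (every torus, every `N, R ≥ 1`,
`d`-only constants apart from `α`): suppose the VALUE one-step law holds in the block `x′` against the source `(x̄, λ)`,
`‖H_{RN}((RN·x̄′+a′,μ),(x̄,λ)) − H_N((N·x̄′+a,μ),(x̄,λ))‖ ≤ ε` for all offsets `a′` with parent `a = ⌊a′∕R⌋` (gan24-p3-g27's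
`HkKingOneStep.norm_HkOp_king_sub_le` gives `ε = KH1(d)∕N·e^{−dec|x′−x|}`).  Then for every parent-related pair `(a′, a)`, every direction `ν`,
every `h` with `1 ≤ h`, `2h ≤ N`, and every `0 ≤ α < 1`:
`‖∂_ν^{(RN)}H_{RN}((RN·x̄′+a′,μ),(x̄,λ)) − ∂_ν^{(N)}H_N((N·x̄′+a,μ),(x̄,λ))‖ ≤ 2·CHR(d,α)·(h∕N)^α·e^{−(κ₁₆₃(d+1)∕(d+1))|x′−x|_T} + 2·(N∕h)·ε`.
[cite: Balaban1984PropagatorsI, (1.63) p.28, p.29 lines 1–2; King1986, p.664 (the parent map)] [folklore] -/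
theorem norm_dker_king_sub_le_of_value_law (μ lam ν : Fin (d + 1)) (x' x : Fin (d + 1) → ℤ) {ε : ℝ}
    (hval : ∀ (a : Fin (d + 1) → Fin N) (a' : Fin (d + 1) → Fin (R * N)), (∀ i, (a' i : ℕ) / R = (a i : ℕ)) →
      ‖HkOp (R * N) M (bpt (R * N) M (toT M x') a', μ) (toT M x, lam) - HkOp N M (bpt N M (toT M x') a, μ) (toT M x, lam)‖ ≤ ε)
    (a : Fin (d + 1) → Fin N) (a' : Fin (d + 1) → Fin (R * N)) (hpar : ∀ i, (a' i : ℕ) / R = (a i : ℕ))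
    {h : ℕ} (hh : 1 ≤ h) (h2 : 2 * h ≤ N) {α : ℝ} (hα0 : 0 ≤ α) (hα1 : α < 1) :
    ‖dker (R * N) M μ lam ν (bpt (R * N) M (toT M x') a') (toT M x) - dker N M μ lam ν (bpt N M (toT M x') a) (toT M x)‖
      ≤ 2 * CHR d α * ((h : ℝ) / N) ^ α * Real.exp (-(kappa163 (d + 1) / (d + 1) * torusSupNorm M (x' - x)))
        + 2 * ((N : ℝ) / h * ε) := by
  have hR : 0 < R := Nat.pos_of_ne_zero (NeZero.ne R)
  by_cases hf : (a ν : ℕ) + h < N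
  · -- forward ray based at `a` / `a′`, evaluated at its start
    have h0 := hval (rayOff N a ν 0) (rayOff (R * N) a' ν (R * 0)) (rayOff_par ν hR a a' hpar 0 (by simp))
    have h1 := hval (rayOff N a ν h) (rayOff (R * N) a' ν (R * h)) (rayOff_par ν hR a a' hpar h hf)
    have hcore := norm_dker_sub_dker_ray_le M μ lam ν x' x a a' hpar hh hf (Nat.zero_le h) hα0 hα1
      (ε₀ := ε) (ε₁ := ε) (by rw [rayPt, rayPt]; rw [Nat.mul_zero] at h0; exact h0) (by rw [rayPt, rayPt]; exact h1)
    rw [Nat.mul_zero, rayPt_zero, rayPt_zero] at hcore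
    calc _ ≤ _ := hcore
      _ = _ := by ring
  · -- backward ray based at `a − h·e_ν` / `a′ − Rh·e_ν`, evaluated at its end
    have hge : h ≤ (a ν : ℕ) := by omega
    have hge' : R * h ≤ (a' ν : ℕ) := mul_le_of_le_par (by rw [hpar ν]; exact hge)
    set c : Fin (d + 1) → Fin N := Function.update a ν ⟨(a ν : ℕ) - h, lt_of_le_of_lt (Nat.sub_le _ _) (a ν).isLt⟩ with hc
    set c' : Fin (d + 1) → Fin (R * N) :=
      Function.update a' ν ⟨(a' ν : ℕ) - R * h, lt_of_le_of_lt (Nat.sub_le _ _) (a' ν).isLt⟩ with hc'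
    have hparc : ∀ i, (c' i : ℕ) / R = (c i : ℕ) := by
      intro i
      by_cases hi : i = ν
      · subst hi
        simp only [hc, hc', Function.update_self, Fin.val_mk]
        rw [sub_mul_div, hpar]
      · simp only [hc, hc', Function.update_of_ne hi]
        exact hpar i
    have hcν : (c ν : ℕ) + h < N := by
      simp only [hc, Function.update_self, Fin.val_mk]
      have := (a ν).isLt; omega
    have hback : rayOff N c ν h = a := rayOff_back ν a hge
    have hback' : rayOff (R * N) c' ν (R * h) = a' := rayOff_back ν a' hge'
    have h0 := hval (rayOff N c ν 0) (rayOff (R * N) c' ν (R * 0)) (rayOff_par ν hR c c' hparc 0 (by simp))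
    have h1 := hval (rayOff N c ν h) (rayOff (R * N) c' ν (R * h)) (rayOff_par ν hR c c' hparc h hcν)
    have hcore := norm_dker_sub_dker_ray_le M μ lam ν x' x c c' hparc hh hcν le_rfl hα0 hα1
      (ε₀ := ε) (ε₁ := ε) (by rw [rayPt, rayPt]; rw [Nat.mul_zero] at h0; exact h0) (by rw [rayPt, rayPt]; exact h1)
    rw [rayPt, rayPt, hback, hback'] at hcore
    calc _ ≤ _ := hcore
      _ = _ := by ring

/-- **THE DEGENERATE CASE `N = 1` (or any level pair): the two decaying sup bounds** —
`‖∂_ν^{(RN)}H_{RN}(·) − ∂_ν^{(N)}H_N(·)‖ ≤ 2·CdecD(d)·e^{−(κ₁₆₃(d+1)∕(d+1))|x′−x|_T}` (`B5Hk163TorusHolderDecay.norm_dker_bpt_le` twice); also the DECAY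
CLAUSE of the constituent at each level. [folklore] -/
theorem norm_dker_trivial_two_levels (μ lam ν : Fin (d + 1)) (x' x : Fin (d + 1) → ℤ) (a : Fin (d + 1) → Fin N)
    (a' : Fin (d + 1) → Fin (R * N)) :
    ‖dker (R * N) M μ lam ν (bpt (R * N) M (toT M x') a') (toT M x) - dker N M μ lam ν (bpt N M (toT M x') a) (toT M x)‖
      ≤ 2 * CdecD d * Real.exp (-(kappa163 (d + 1) / (d + 1) * torusSupNorm M (x' - x))) := by
  have h1 := norm_dker_bpt_le (R * N) M μ lam ν a' x' x
  have h2 := norm_dker_bpt_le N M μ lam ν a x' x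
  calc _ ≤ ‖dker (R * N) M μ lam ν (bpt (R * N) M (toT M x') a') (toT M x)‖ + ‖dker N M μ lam ν (bpt N M (toT M x') a) (toT M x)‖ :=
        norm_sub_le _ _
    _ ≤ _ := by unfold CdecD; linarith

/-- `2·CdecD(d) ≤ CHR(d,α)` — the degenerate bound is dominated by the Hölder constant (`CHR = max(…, 2·CdecD)`). [folklore] -/
theorem two_CdecD_le_CHR (α : ℝ) : 2 * CdecD d ≤ CHR d α := le_max_right _ _

end Law

end Summit.QuantumFields.BalabanUV.Beta.GAN24.HkGradientKingOneStep

end
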